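import Mathlib
import Summits.ResolutionOfSingularities.ResolutionOfSingularities.Theorems.FrobeniusClosingSteerRadicandChainRealisationQT
import HarnessLib

/-!
# Crux `Steer` (stmt-ResolutionOfSingularities-16345), chain W4.1, R2 σ_top line: **K(2) realisation layer —
# main theorem `exists_realisation`**

OURS (campaign `res-hironaka`, rung L ★L-G4, slot W4.1; seat `res-L1-type-o8` = `res-D-pv-015`; this is the
REALISATION HALF of res-L0-w41-plan-1's ORDER 05:10:18Z «K(2) = `∀ p prime, NoEternalIsolatedRadicandChain p 2` from
the named fact `Literature.AlgebraicGeometry.Resolution.Lipman1978NoEternalNormalBranch`», SPLIT agreed with the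
K(2) holder res-type-026 05:29:44Z; shape of the conclusion = the hypotheses `hR0 hN0 hE0 hQT hdimR` of the holder's
`RadicandChainTwo.false_of_realisation`, `Theorems/FrobeniusClosingSteerRadicandChainTwo.lean`).  Not a statement of
the manuscript under review; AI review is weaker than expert review.

`exists_realisation p hp c`: under the binders of idea-1's `NoEternalIsolatedRadicandChain p c`
(`L/w41/Sketch-R2-steered.lean` §3.1 VERBATIM, bodies of `RadicandRing` / `HasIsolatedSingularity` unfolded exactly as
in `NoEternalChainOne.noEternalIsolatedRadicandChain_one`), the radicand rings `S m[θ]/(θ^p − f m)` are realised as a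
chain `R : ℕ → Subring K′` of LOCAL subrings of ONE field `K′ = Frac(S 0)[θ]/(θ^p − f 0)` with ring isomorphisms
`e m : S m[θ]/(θ^p − f m) ≃+* R m`, such that `R 0` is a local ring OF `K′` (fraction field `K′`), Noetherian and
excellent, every `R (m+1)` is a quadratic transform of `R m` (Cutkosky §2.1), and `dim R m = c` — i.e. exactly the
hypotheses of `Lipman1978NoEternalNormalBranch` except normality.  Ingredients: `…RealisationBase` (locality;
isolatedness ⇒ no `p`-th root of `f m` among fractions, whence `K′` is a field and the `e m` are injective),
`…RealisationTower` (the tower `θ (m+1) = (θ m − g m)/x m`), `…RealisationLayerOne` (fractions, excellence —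
Matsumura §32 p. 260 PROVED in the tree —, dimension), `…RealisationQT` (the quadratic transform law).
The regularity binder is not used.

K(2) itself (`c = 2`) is closed BY NAME by the holder's leaf `RadicandChainTwo.noEternalIsolatedRadicandChain_two`
(res-type-026, its own realisation + `false_of_realisation` p502783); this `c`-generic realisation is the one of
record for every `c` (e.g. the K(3) slot at `c = 3`).
[cite: Cutkosky2014, §2.1] [cite: Matsumura1987, §32 p. 260; Thm 9.4] [folklore]
-/

noncomputable section

-- `Summit.<S>.<S>.…` duplicates the summit name by design (single-problem summit).
set_option linter.dupNamespace false

open Polynomial IsLocalRing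

namespace Summit.ResolutionOfSingularities.ResolutionOfSingularities.Theorems.SwitchingDichotomy

namespace RadicandChainRealisation

open Literature.AlgebraicGeometry.Resolution

/-- **K(2) realisation layer — the radicand rings of an isolated radicand chain form a chain of quadratic
transforms of local subrings of one field.**  Binders = the VERBATIM prefix of `NoEternalIsolatedRadicandChain p c`
(idea-1, `L/w41/Sketch-R2-steered.lean` §3.1; bodies unfolded); conclusion = the data and hypotheses of
`Lipman1978NoEternalNormalBranch` except `IsIntegrallyClosed`, together with the realisation isomorphisms `e m`.
OURS. [cite: Cutkosky2014, §2.1] [cite: Matsumura1987, §32 p. 260; Thm 9.4] [folklore] -/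
theorem exists_realisation (p : ℕ) (hp : p.Prime) (c : ℕ) :
    ∀ (L : Type) [Field L] [CharP L p] (S : ℕ → Subring L) [∀ m, IsLocalRing (S m)]
      (hle : ∀ m, S m ≤ S (m + 1)) (f g : ∀ m, S m) (x : ∀ m, S (m + 1)),
      (∀ m, IsRegularLocalRing (S m)) → (∀ m, IsExcellentRing (S m)) → (∀ m, ringKrullDim (S m) = (c : ℕ)) →
      (∀ m, IsQuadraticTransform (S m) (S (m + 1))) →
      (∀ m, Ideal.span ((fun y : S m => (⟨(y : L), hle m y.2⟩ : S (m + 1))) ''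
          (maximalIdeal (S m) : Set (S m))) = Ideal.span {x m}) →
      (∀ m, ((f (m + 1) : S (m + 1)) : L) * ((x m : S (m + 1)) : L) ^ p =
          ((f m : S m) : L) - ((g m : S m) : L) ^ p) →
      (∀ m, ∃ h : S m, f m - h ^ p ∈ maximalIdeal (S m) ^ p) →
      (∀ m, ∀ (P : Ideal (AdjoinRoot ((X : (S m)[X]) ^ p - C (f m)))) [P.IsPrime],
          (∃ Q : Ideal (AdjoinRoot ((X : (S m)[X]) ^ p - C (f m))), Q.IsPrime ∧ P < Q) →
          IsRegularLocalRing (Localization.AtPrime P)) →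
      ∃ (Kp : Type) (_ : Field Kp) (R : ℕ → Subring Kp)
        (_ : ∀ m, AdjoinRoot ((X : (S m)[X]) ^ p - C (f m)) ≃+* R m),
        IsLocalRingOf (R 0) ∧ IsNoetherianRing (R 0) ∧ IsExcellentRing (R 0) ∧
        (∀ m, IsQuadraticTransform (R m) (R (m + 1))) ∧ (∀ m, ringKrullDim (R m) = (c : ℕ)) := by
  intro L _ _ S _ hle f g x _hreg hexc hdim hQT hspan hrel hmult hisol
  haveI := Fact.mk hp
  -- (0) the exceptional parameters are non-zero; the members are not fields
  have hx0 : ∀ m, (x m : L) ≠ 0 := fun m => by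
    obtain ⟨_, x', hx'𝔪, hx'0, _, hbl, -, -⟩ := hQT m
    obtain ⟨-, -, -, -, -, h⟩ := exists_unit_ratio (hle m) hx'𝔪 (fun e => hx'0 (Subtype.ext e)) hbl (hspan m)
    exact h
  have hnf : ∀ m, ¬ IsField (S m) := fun m hF => by
    obtain ⟨_, x', hx'𝔪, hx'0, -⟩ := hQT m
    rw [isField_iff_maximalIdeal_eq.mp hF, Ideal.mem_bot] at hx'𝔪
    exact hx'0 hx'𝔪
  -- (1) every member lies in the field of fractions of `S 0`
  have hsub : ∀ n, (S n : Set L) ⊆ (Subfield.closure (S 0 : Set L) : Set L) := by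
    intro n
    induction n with
    | zero => exact Subfield.subset_closure
    | succ n ih =>
      intro s hs
      obtain ⟨_, x', _, _, _, _, hfrac, -⟩ := hQT n
      obtain ⟨a, ha, b, hb, -, rfl⟩ := hfrac s hs
      have hBl : ∀ z, z ∈ blowupRing (S n) (x' : L) → z ∈ Subfield.closure (S 0 : Set L) := by
        intro z hz
        unfold blowupRing at hz
        induction hz using Subring.closure_induction with
        | mem z h =>
          rcases h with h | ⟨y, _, rfl⟩
          · exact ih h
          · exact div_mem (ih y.2) (ih x'.2)
        | zero => exact zero_mem _
        | one => exact one_mem _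
        | add _ _ _ _ ha hb => exact add_mem ha hb
        | neg _ _ ha => exact neg_mem ha
        | mul _ _ _ _ ha hb => exact mul_mem ha hb
      exact div_mem (hBl a ha) (hBl b hb)
  have hfrac0 : ∀ n (s : S n), ∃ u v : S 0, (v : L) ≠ 0 ∧ (s : L) = (u : L) / (v : L) := by
    intro n s
    obtain ⟨u, hu, v, hv, huv⟩ := Subfield.mem_closure_iff.mp (hsub n s.2)
    rw [Subring.closure_eq] at hu hv
    by_cases hv0 : v = 0
    · refine ⟨0, 1, by simp, ?_⟩
      rw [← huv, hv0, div_zero]; simp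
    · exact ⟨⟨u, hu⟩, ⟨v, hv⟩, hv0, huv.symm⟩
  -- (2) isolatedness: no `p`-th root of `f m` among the fractions of `S m`; so `K′` is a field
  have hnr : ∀ m (u v : S m), v ≠ 0 → ((u : L) / (v : L)) ^ p ≠ (f m : L) :=
    fun m u v hv => pow_ne_of_isolated (S m) (hnf m) (f m) (hisol m) u v hv
  have hirr : Irreducible (radPoly p S f) := by
    refine X_pow_sub_C_irreducible_of_prime hp fun b hb => ?_
    have hbL : (b : L) ∈ Subfield.closure (S 0 : Set L) := by
      refine (Subfield.closure_le.mpr ?_) b.2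
      exact Set.iUnion_subset hsub
    obtain ⟨u, hu, v, hv, huv⟩ := Subfield.mem_closure_iff.mp hbL
    rw [Subring.closure_eq] at hu hv
    have hb' : ((b : L)) ^ p = (f 0 : L) := by
      have := congrArg (fun z : baseField S => (z : L)) hb
      simpa using this
    by_cases hv0 : v = 0
    · apply hnr 0 0 1 one_ne_zero
      rw [← hb', ← huv, hv0, div_zero]; simp [zero_pow hp.ne_zero]
    · exact hnr 0 ⟨u, hu⟩ ⟨v, hv⟩ (fun h => hv0 (congrArg Subtype.val h)) (by simpa [huv] using hb')
  haveI : Fact (Irreducible (radPoly p S f)) := ⟨hirr⟩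
  -- (3) the tower relation `(θ m)^p = f m` and injectivity of the realisation maps
  have hθ : ∀ m, theta p S f g x m ^ p = emb p S f m (f m) := theta_pow p S f g x hx0 hrel
  have hinj : ∀ m, Function.Injective (phi p S f g x hθ m) := fun m =>
    phi_injective p S f g x hθ m fun u v hv => hnr m u v hv
  haveI := fun m => isLocalRing_adjoinRoot_member p S f m (hmult m)
  haveI := fun m => isLocalRing_realR p S f g x hθ m (hinj m) (hmult m)
  -- (4) assemble
  refine ⟨AdjoinRoot (radPoly p S f), inferInstance, realR p S f g x hθ,
    fun m => equivRealR p S f g x hθ m (hinj m), ?_, ?_, ?_, ?_, ?_⟩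
  · exact ⟨inferInstance, exists_frac_of_realR_zero p S f g x hθ hfrac0⟩
  · exact isNoetherianRing_realR_zero p S f g x hθ (hinj 0) (hexc 0)
  · exact isExcellentRing_realR_zero p S f g x hθ (hinj 0) (hexc 0)
  · exact fun m => isQuadraticTransform_realR p S f g x hθ hle hx0 m hinj hmult (hQT m) (hspan m) (hrel m)
  · exact fun m => (ringKrullDim_realR p S f g x hθ m (hinj m)).trans (hdim m)

end RadicandChainRealisation

end Summit.ResolutionOfSingularities.ResolutionOfSingularities.Theorems.SwitchingDichotomy

end
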